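import Literature.InformationTheory.QuantumCodes.QuaternaryMacWilliams
import HarnessLib

/-!
# `GF(4)`-linearity of additive codes: multiplication by `ω`, even codes, CRSS Theorems 3 and 4 — proved

Source (Calderbank–Rains–Shor–Sloane 1998, §3, printed pp. 9–12; arXiv:quant-ph/9608006 chunks p0010 L20–30,
p0011 L1–20, p0012 L1–8, p0013 L1–9): "To each vector `v = (a|b) ∈ Ē` we associate the vector
`φ(v) = ωa + ω̄b ∈ GF(4)ⁿ`. … the weight of `v` is equal to the Hamming weight of `φ(v)` … The symplectic inner
product of `v` and `v′` is equal to `Tr(φ(v)·\overline{φ(v′)})` … If `C` is also closed under multiplication by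
`ω`, we say it is *linear*. … **Theorem 3.** A linear code `C` is self-orthogonal (with respect to the trace inner
product (4)) if and only if it is classically self-orthogonal with respect to the hermitian inner product.
*Proof.* … For `u, v ∈ C` let `u·v̄ = α + βω`, `α, β ∈ ℤ₂`. Then `Tr(u·v̄) = 0` implies `β = 0`, and
`Tr(u·ω̄v̄) = 0` implies `α = 0` … An `(n, 2^k)` code is called *even* if the weight of every codeword is even …
**Theorem 4.** An even additive code is self-orthogonal. A self-orthogonal linear code is even. *Proof.* The first
assertion holds because `wt(u+v) ≡ wt(u) + wt(v) + u ∗ v (mod 2)` (7) …, and the second because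
`u ∗ (ωu) ≡ wt(u) (mod 2)` (8)."

In the tree's binary language (`SymplecticCodes.lean`; eq. (7) is `natCast_sympWeight_add` in
`QuaternaryMacWilliams.lean`) this file adds:

* `omegaMul n : Ē_n ≃ₗ Ē_n`, `(a|b) ↦ (b | a+b)` — multiplication by `ω` transported through `φ`
  (`ω·(ωa + ω̄b) = ω̄a + b = ωb + ω̄(a+b)` using `ω² = ω̄`, `ω³ = 1`, `1 = ω + ω̄`); `omegaMul_omegaMul_omegaMul`
  (`ω³ = 1`), `sympWeight_omegaMul`, `sympInner_omegaMul` ("`G_n` preserves weights and trace inner products");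
* eq. (8): `natCast_sympWeight_eq_sympInner_omegaMul` — `wt(u) ≡ (u, ωu) (mod 2)`;
* `IsGF4Linear S` (closed under `ω`), `IsEvenCode S` (all weights even), `IsHermOrthogonal u v` (`u·v̄ = 0`,
  i.e. `β = (u,v) = 0` and `α = (u, ωv) = 0`);
* `CRSS1998_theorem4a` (`IsEvenCode S → IsSelfOrthogonal S`), `CRSS1998_theorem4b`
  (`IsSelfOrthogonal S → IsGF4Linear S → IsEvenCode S`), `CRSS1998_theorem3`.

All statements are theorems (no named facts). This is the vocabulary needed for the `GF(4)`-linear constructions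
of CRSS §4–5 (Lemma 2, Thm. 7, cyclic codes) and for the "linear" marks of their tables.

## References
* [CalderbankEtAl1998] A. R. Calderbank, E. M. Rains, P. W. Shor, N. J. A. Sloane, *Quantum error correction via
  codes over GF(4)*, IEEE Trans. Inform. Theory 44 (1998) 1369–1387, arXiv:quant-ph/9608006, §3 (pp. 9–12).
-/

namespace Literature.InformationTheory.QuantumCodes

open Finset Matrix

variable {n : ℕ}

/-! ### Multiplication by `ω` -/

/-- **Multiplication by `ω`** on `Ē_n`, transported through `φ(a|b) = ωa + ω̄b`: `ω·φ(a|b) = φ(b | a+b)`, so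
`ω·(a|b) = (b | a+b)`; its inverse (multiplication by `ω̄ = ω²`) is `(a|b) ↦ (a+b | a)`.
[cite: CalderbankEtAl1998, §3 (printed pp. 9–10: "φ(v) = ωa + ω̄b"; "closed under multiplication by ω")] -/
def omegaMul (n : ℕ) : SympVec n ≃ₗ[ZMod 2] SympVec n where
  toFun v := (v.2, v.1 + v.2)
  invFun v := (v.1 + v.2, v.1)
  map_add' v w := by
    refine Prod.ext rfl ?_
    simp only [Prod.snd_add, Prod.fst_add]
    abel
  map_smul' c v := by
    refine Prod.ext rfl ?_
    simp only [Prod.smul_snd, Prod.smul_fst, smul_add, RingHom.id_apply]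
  left_inv v := by
    refine Prod.ext (funext fun i => ?_) rfl
    show v.2 i + (v.1 i + v.2 i) = v.1 i
    generalize v.1 i = a; generalize v.2 i = b; revert a b; decide
  right_inv v := by
    refine Prod.ext rfl (funext fun i => ?_)
    show (v.1 i + v.2 i) + v.1 i = v.2 i
    generalize v.1 i = a; generalize v.2 i = b; revert a b; decide

/-- `ω·(a|b) = (b | a+b)`. [cite: CalderbankEtAl1998, §3 (printed pp. 9–10)] -/
@[simp] theorem omegaMul_apply (v : SympVec n) : omegaMul n v = (v.2, v.1 + v.2) := rfl

/-- `ω³ = 1`. [cite: CalderbankEtAl1998, §3 (printed p. 9: "ω² = ω + 1, ω³ = 1")] -/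
theorem omegaMul_omegaMul_omegaMul (v : SympVec n) : omegaMul n (omegaMul n (omegaMul n v)) = v := by
  refine Prod.ext (funext fun i => ?_) (funext fun i => ?_) <;>
    simp only [omegaMul_apply, Pi.add_apply] <;>
    · generalize v.1 i = a; generalize v.2 i = b; revert a b; decide

/-- Multiplication by `ω` preserves weights ("`G_n` preserves weights and trace inner products").
[cite: CalderbankEtAl1998, §3 (printed p. 11)] -/
theorem sympWeight_omegaMul (v : SympVec n) : sympWeight (omegaMul n v) = sympWeight v := by
  unfold sympWeight
  refine congrArg Finset.card (Finset.filter_congr fun i _ => ?_)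
  simp only [omegaMul_apply, Pi.add_apply]
  generalize v.1 i = a; generalize v.2 i = b; revert a b; decide

/-- Multiplication by `ω` preserves the trace/symplectic inner product.
[cite: CalderbankEtAl1998, §3 (printed p. 11: "G_n preserves weights and trace inner products")] -/
theorem sympInner_omegaMul (u v : SympVec n) : sympInner (omegaMul n u) (omegaMul n v) = sympInner u v := by
  simp only [sympInner, omegaMul_apply, dotProduct_add]
  rw [dotProduct_comm u.2 v.1, dotProduct_comm v.2 u.1, dotProduct_comm v.2 u.2]
  linear_combination CharTwo.add_self_eq_zero (u.2 ⬝ᵥ v.2)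

/-- **CRSS eq. (8)**: `u ∗ (ωu) ≡ wt(u) (mod 2)`. [cite: CalderbankEtAl1998, §3 eq. (8) (printed p. 12)] -/
theorem natCast_sympWeight_eq_sympInner_omegaMul (u : SympVec n) :
    ((sympWeight u : ℕ) : ZMod 2) = sympInner u (omegaMul n u) := by
  unfold sympWeight
  rw [Finset.card_filter, Nat.cast_sum]
  simp only [sympInner, omegaMul_apply, dotProduct, Pi.add_apply, ← Finset.sum_add_distrib]
  refine Finset.sum_congr rfl fun i _ => ?_
  push_cast
  generalize u.1 i = a; generalize u.2 i = b; revert a b; decide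

/-! ### Linear and even codes; Theorems 3 and 4 -/

/-- `S̄` is **linear** (over `GF(4)`): closed under multiplication by `ω`.
[cite: CalderbankEtAl1998, §3 (printed p. 10: "If C is also closed under multiplication by ω, we say it is linear")] -/
def IsGF4Linear (S : Submodule (ZMod 2) (SympVec n)) : Prop := ∀ v ∈ S, omegaMul n v ∈ S

/-- `S̄` is **even**: the weight of every codeword is even.
[cite: CalderbankEtAl1998, §3 (printed p. 12: "An (n, 2^k) code is called even if the weight of every codeword is even")] -/
def IsEvenCode (S : Submodule (ZMod 2) (SympVec n)) : Prop := ∀ v ∈ S, Even (sympWeight v)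

/-- **Hermitian orthogonality** `u·v̄ = 0` in `GF(4)ⁿ`, through the dictionary: with `u·v̄ = α + βω` one has
`β = Tr(u·v̄) = (u, v)` and `α = Tr(u·ω̄v̄) = Tr(u·\overline{ωv}) = (u, ωv)`.
[cite: CalderbankEtAl1998, §3 proof of Thm. 3 (printed p. 11)] -/
def IsHermOrthogonal (u v : SympVec n) : Prop := sympInner u v = 0 ∧ sympInner u (omegaMul n v) = 0

variable {S : Submodule (ZMod 2) (SympVec n)}

/-- The whole space and the zero space are linear. [cite: CalderbankEtAl1998, §3 (printed p. 10)] -/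
theorem isGF4Linear_top : IsGF4Linear (⊤ : Submodule (ZMod 2) (SympVec n)) := fun _ _ => Submodule.mem_top

/-- The zero code is linear. [cite: CalderbankEtAl1998, §3 (printed p. 10)] -/
theorem isGF4Linear_bot : IsGF4Linear (⊥ : Submodule (ZMod 2) (SympVec n)) := fun v hv => by
  rw [Submodule.mem_bot] at hv ⊢
  rw [hv, map_zero]

/-- A linear code is also closed under `ω̄ = ω²`. [cite: CalderbankEtAl1998, §3 (printed p. 10)] -/
theorem IsGF4Linear.omegaMul_omegaMul_mem (hL : IsGF4Linear S) {v : SympVec n} (hv : v ∈ S) :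
    omegaMul n (omegaMul n v) ∈ S :=
  hL _ (hL v hv)

/-- The dual of a linear code is linear (`(u, ωv) = (ω²u, ω³v) = (ω̄u, v)`).
[cite: CalderbankEtAl1998, §3 (printed pp. 10–11)] -/
theorem IsGF4Linear.sympDual (hL : IsGF4Linear S) : IsGF4Linear (sympDual S) := by
  intro v hv
  rw [mem_sympDual_iff] at hv ⊢
  intro u hu
  have key : sympInner u (omegaMul n v) = sympInner (omegaMul n (omegaMul n u)) v := by
    conv_lhs => rw [← omegaMul_omegaMul_omegaMul u]
    exact sympInner_omegaMul _ _
  rw [key]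
  exact hv _ (hL.omegaMul_omegaMul_mem hu)

/-- **CRSS Theorem 4, first assertion**: an even additive code is self-orthogonal (by eq. (7)).
[cite: CalderbankEtAl1998, §3 Thm. 4 (printed p. 12)] -/
theorem CRSS1998_theorem4a (hS : IsEvenCode S) : IsSelfOrthogonal S := by
  intro v hv
  rw [mem_sympDual_iff]
  intro u hu
  have h := natCast_sympWeight_add u v
  rw [ZMod.natCast_eq_zero_iff_even.2 (hS _ (S.add_mem hu hv)), ZMod.natCast_eq_zero_iff_even.2 (hS u hu),
    ZMod.natCast_eq_zero_iff_even.2 (hS v hv), zero_add, zero_add] at h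
  exact h.symm

/-- **CRSS Theorem 4, second assertion**: a self-orthogonal linear code is even (by eq. (8): `wt u ≡ (u, ωu) = 0`).
[cite: CalderbankEtAl1998, §3 Thm. 4 (printed p. 12)] -/
theorem CRSS1998_theorem4b (hS : IsSelfOrthogonal S) (hL : IsGF4Linear S) : IsEvenCode S := by
  intro v hv
  rw [← ZMod.natCast_eq_zero_iff_even, natCast_sympWeight_eq_sympInner_omegaMul]
  exact mem_sympDual_iff.1 (hS (hL v hv)) v hv

/-- **CRSS Theorem 3**: a linear code is self-orthogonal for the trace inner product iff it is (classically)
self-orthogonal for the hermitian inner product. [cite: CalderbankEtAl1998, §3 Thm. 3 (printed p. 11)] -/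
theorem CRSS1998_theorem3 (hL : IsGF4Linear S) :
    IsSelfOrthogonal S ↔ ∀ u ∈ S, ∀ v ∈ S, IsHermOrthogonal u v := by
  constructor
  · intro hS u hu v hv
    exact ⟨mem_sympDual_iff.1 (hS hv) u hu, mem_sympDual_iff.1 (hS (hL v hv)) u hu⟩
  · intro h v hv
    exact mem_sympDual_iff.2 fun u hu => (h u hu v hv).1

/-! ### Generator criteria; the five-qubit Hamming code is linear and even -/

/-- Linearity can be checked on generators: `span(r)` is linear iff `ω·rᵢ ∈ span(r)` for every generator.
[cite: CalderbankEtAl1998, §3 (printed p. 11: "If the code is linear a k/2 × n generator matrix will suffice")] -/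
theorem isGF4Linear_span_range_iff {ι : Type*} (r : ι → SympVec n) :
    IsGF4Linear (Submodule.span (ZMod 2) (Set.range r)) ↔
      ∀ i, omegaMul n (r i) ∈ Submodule.span (ZMod 2) (Set.range r) := by
  constructor
  · exact fun h i => h _ (Submodule.subset_span ⟨i, rfl⟩)
  · intro h v hv
    refine Submodule.span_induction (fun x hx => ?_) ?_ (fun x y _ _ hx hy => ?_) (fun c x _ hx => ?_) hv
    · obtain ⟨i, rfl⟩ := hx; exact h i
    · rw [map_zero]; exact Submodule.zero_mem _
    · rw [map_add]; exact Submodule.add_mem _ hx hy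
    · rw [map_smul]; exact Submodule.smul_mem _ c hx

/-- Self-orthogonality can be checked on generators: pairwise orthogonal generators span a self-orthogonal code.
[cite: CalderbankEtAl1998, §3 (printed pp. 10–11: additive codes given by generator matrices)] -/
theorem isSelfOrthogonal_span_range {ι : Type*} (r : ι → SympVec n) (h : ∀ i j, sympInner (r i) (r j) = 0) :
    IsSelfOrthogonal (Submodule.span (ZMod 2) (Set.range r)) := by
  have h1 : ∀ i, ∀ v ∈ Submodule.span (ZMod 2) (Set.range r), sympInner v (r i) = 0 := by
    intro i v hv
    refine Submodule.span_induction (fun x hx => ?_) ?_ (fun x y _ _ hx hy => ?_) (fun c x _ hx => ?_) hv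
    · obtain ⟨j, rfl⟩ := hx; exact h j i
    · exact sympInner_zero_left _
    · rw [sympInner_add_left, hx, hy, add_zero]
    · rw [sympInner_smul_left, hx, mul_zero]
  intro v hv
  rw [mem_sympDual_iff]
  intro u hu
  refine Submodule.span_induction (fun x hx => ?_) ?_ (fun x y _ _ hx hy => ?_) (fun c x _ hx => ?_) hu
  · obtain ⟨i, rfl⟩ := hx
    rw [sympInner_comm]; exact h1 i v hv
  · exact sympInner_zero_left _
  · rw [sympInner_add_left, hx, hy, add_zero]
  · rw [sympInner_smul_left, hx, mul_zero]

/-- **The five-qubit code is linear** (it is the `[[5,1,3]]` Hamming code over `GF(4)`): each `ω·(generator)` is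
a sum of generators — checked by `decide` on the `4 × 10` binary stabilizer matrix.
[cite: CalderbankEtAl1998, §4 (printed p. 13: "the [[5,1,3]] Hamming code (see Section 5)") and §5] -/
theorem isGF4Linear_fiveQubitCode : IsGF4Linear fiveQubitCode :=
  (isGF4Linear_span_range_iff fiveQubitRows).2 fun i =>
    (Submodule.mem_span_range_iff_exists_fun (ZMod 2)).2 (by revert i; decide)

/-- The five-qubit code is self-orthogonal (its generators pairwise commute, `sympInner_fiveQubitRows`).
[cite: Gottesman1997, §3.4; CalderbankEtAl1998, §5] -/
theorem isSelfOrthogonal_fiveQubitCode : IsSelfOrthogonal fiveQubitCode :=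
  isSelfOrthogonal_span_range fiveQubitRows sympInner_fiveQubitRows

/-- **The five-qubit code is even** (Theorem 4: self-orthogonal and linear).
[cite: CalderbankEtAl1998, §3 Thm. 4 (printed p. 12)] -/
theorem isEvenCode_fiveQubitCode : IsEvenCode fiveQubitCode :=
  CRSS1998_theorem4b isSelfOrthogonal_fiveQubitCode isGF4Linear_fiveQubitCode

/-! ### A linear code has even binary dimension (`(n, 2^k)` with `k` even: "a `k/2 × n` generator matrix") -/

/-- `ω` has no nonzero fixed vector: `ω·v = v → v = 0`. [cite: CalderbankEtAl1998, §3 (printed p. 9: "ω² = ω + 1")] -/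
theorem omegaMul_eq_self_iff (v : SympVec n) : omegaMul n v = v ↔ v = 0 := by
  constructor
  · intro h
    have h1 : ∀ i, v.2 i = v.1 i := fun i => by
      have := congrArg (fun w : SympVec n => w.1 i) h
      simpa using this
    have h2 : ∀ i, v.1 i + v.2 i = v.2 i := fun i => by
      have := congrArg (fun w : SympVec n => w.2 i) h
      simpa using this
    refine Prod.ext (funext fun i => ?_) (funext fun i => ?_)
    · show v.1 i = 0
      have a := h1 i; have b := h2 i
      revert a b; generalize v.1 i = x; generalize v.2 i = y; revert x y; decide
    · show v.2 i = 0
      have a := h1 i; have b := h2 i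
      revert a b; generalize v.1 i = x; generalize v.2 i = y; revert x y; decide
  · rintro rfl; exact map_zero _

/-- **A linear code has an even number of binary generators**: if `S̄` is closed under `ω` then `dim_𝔽₂ S̄` is
even (`S̄` is a `GF(4)`-space; "If the code is linear a `k/2 × n` generator matrix will suffice"). Proof: `ω`
permutes `S̄` with `ω³ = 1` and no fixed point other than `0`, so `|S̄| = 2^{dim} ≡ 1 (mod 3)`.
[cite: CalderbankEtAl1998, §3 (printed p. 11: "If the code is linear a k/2 × n generator matrix will suffice")] -/
theorem IsGF4Linear.even_finrank (hL : IsGF4Linear S) : Even (Module.finrank (ZMod 2) S) := by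
  classical
  -- `ω` restricted to `S̄` as an endofunction with `f³ = 1`
  let f : Function.End ↥S := fun x => ⟨omegaMul n x, hL x.1 x.2⟩
  have hf3 : ∀ x : ↥S, f (f (f x)) = x := fun x => Subtype.ext (omegaMul_omegaMul_omegaMul x.1)
  have hf : f ^ 3 ^ 1 = 1 := by
    funext x
    show f^[3] x = x
    simp only [Function.iterate_succ, Function.iterate_zero, Function.comp_apply, id_eq]
    exact hf3 x
  have hmod := Equiv.Perm.card_fixedPoints_modEq (p := 3) (n := 1) hf
  -- the only fixed point is `0`
  have hfix : Fintype.card (Function.fixedPoints f) = 1 := by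
    refine Fintype.card_eq_one_iff.2 ⟨⟨0, ?_⟩, fun y => Subtype.ext ?_⟩
    · show f 0 = 0
      exact Subtype.ext (map_zero (omegaMul n))
    · have hy : f y.1 = y.1 := y.2
      have : omegaMul n (y.1 : SympVec n) = y.1 := congrArg Subtype.val hy
      exact Subtype.ext ((omegaMul_eq_self_iff _).1 this)
  rw [hfix, Module.card_eq_pow_finrank (K := ZMod 2) (V := ↥S), ZMod.card] at hmod
  -- `2 ^ k ≡ 1 (mod 3)` forces `k` even
  set k := Module.finrank (ZMod 2) ↥S
  rcases Nat.even_or_odd k with hk | hk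
  · exact hk
  · exfalso
    obtain ⟨j, hj⟩ := hk
    have h4j : ∀ j : ℕ, ((2 : ℕ) ^ 2) ^ j % 3 = 1 := by
      intro j
      induction j with
      | zero => rfl
      | succ j ih => rw [pow_succ, Nat.mul_mod, ih]; norm_num
    have h4 : 2 ^ k % 3 = 2 := by
      rw [hj, pow_succ, pow_mul, Nat.mul_mod, h4j j]
    have h5 : 2 ^ k % 3 = 1 := hmod
    rw [h4] at h5
    exact absurd h5 (by norm_num)

end Literature.InformationTheory.QuantumCodes
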